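import Literature.AlgebraicGeometry.HodgeTheory.ChernCharacterClass
import Literature.AlgebraicGeometry.HodgeTheory.GAGALineBundlesOfSections
import Literature.AlgebraicGeometry.HodgeTheory.TautologicalCocycleLinEquivUnits
import Literature.AlgebraicGeometry.Motives.AnalytificationTautologicalBundle
import Literature.Geometry.Kaehler.ChernCharacterCocycleIso
import Literature.Geometry.Kaehler.HolomorphicLineBundleMetric
import Literature.Geometry.Kaehler.LocalForms
import HarnessLib

/-!
# Chern character calculus for the cocycles `𝒪_X(D)^an` of Cartier divisors

Family `hodge`, layer `Literature/AlgebraicGeometry/HodgeTheory`. The dictionary "Cartier divisors ↔ holomorphic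
line cocycles ↔ first Chern character classes" on a Hodge model `A` of a smooth projective complex variety `X`
(`cartierDivisorCocycle A.isAnalytification D`, the cocycle `𝒪_X(D)^an` with transition functions `f_i/f_j`,
Görtz–Wedhorn I (11.9) read on `X^an`; `HodgeModel.chernCharacter`, Chern–Weil). Write
`ch(D) := ch₁(𝒪_X(D)^an) ∈ H²(X(ℂ); ℂ)`. PROVED here:

* `HolomorphicLineBundle.HermitianMetric.exists_tensor_localChernForm_eq_add`,
  `HodgeModel.chernCharacter_tensor_toSmoothCocycle` — **`ch₁(L ⊗ L') = ch₁(L) + ch₁(L')`** for cocycle line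
  bundles (Voisin I, §3.3.1: the product metric `h_i h'_k` has Chern form `ω_i + ω'_k`; Kobayashi II (1.10));
* `HolomorphicLineBundle.HermitianMetric.exists_localChernForm_eq_neg_of_inv`,
  `HodgeModel.chernCharacter_toSmoothCocycle_eq_neg_of_inv` — **`ch₁(L⁻¹) = -ch₁(L)`** for the inverse cocycle
  `g_ji` (the metric `h_i⁻¹`);
* `HodgeModel.chernCharacter_eq_of_analyticallyEquivalent` — isomorphic cocycles have equal `ch_p`
  (`CocycleIso.chernCharacterDeRham_eq`, Kobayashi II §1 Axiom 2);
* `HodgeModel.chernCharacter_cartierDivisorCocycle_add` — **`ch(D + D') = ch(D) + ch(D')`** (`𝒪(D + D')^an` IS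
  the tensor product cocycle, Görtz–Wedhorn I Prop. 11.21);
* `analyticallyEquivalent_cartierDivisorCocycle_of_isUnitAt`,
  `HodgeModel.chernCharacter_cartierDivisorCocycle_eq_of_linEquiv` — **`D ∼ D' ⟹ ch(D) = ch(D')`**: the units
  `f'_a / (f_i h)` of a linear equivalence (`CartierDivisor.linEquiv_iff`) are the matrices of a holomorphic
  isomorphism `𝒪(D)^an ≅ 𝒪(D')^an` (Fritzsche–Grauert IV §2 (C));
* `HodgeModel.chernCharacter_cartierDivisorCocycle_smul` — **`ch(m • D) = m • ch(D)`**;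
* `analyticallyEquivalent_cartierDivisorCocycle_divisor`,
  `HodgeModel.chernCharacter_cartierDivisorCocycle_divisor_eq_neg` — for a morphism `Ψ : X ⟶ ℙᴷ` the
  cocycle of the hyperplane divisor `D_Ψ = (Ψ^*x_j)` (`GeneratingSections.divisor`) has transition functions
  `Ψ^*(x_b/x_a)`, INVERSE to those of the tautological cocycle `𝒪(-1)|_X` (`tautologicalBundle Ψ`), whence
  **`ch(D_Ψ) = -ch₁(𝒪(-1)|_X)`** for a closed immersion `Ψ` (Griffiths–Harris p. 145: `J = [-H]`).

Everything is proved; no definitions, no named facts.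

## References

* C. Voisin, *Hodge Theory and Complex Algebraic Geometry I* (CUP 2002), §3.3.1, §3.3.2, Thm. 4.49, Thm. 7.10,
  §11.1.2. [VoisinHodgeI2002]
* S. Kobayashi, *Differential Geometry of Complex Vector Bundles* (1987), Ch. I §1 (1.15), Ch. II §1 (1.10), Axiom 2,
  §2 Thm. 2.16. [Kobayashi1987]
* U. Görtz, T. Wedhorn, *Algebraic Geometry I*, 2nd ed. (2020), (11.9), Prop. 11.21, Def. 11.26. [GortzWedhorn2020]
* P. Griffiths, J. Harris, *Principles of Algebraic Geometry* (1978), Ch. 1 §1 pp. 144–145. [GriffithsHarris1978]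
* K. Fritzsche, H. Grauert, *From Holomorphic Functions to Complex Manifolds* (2002), Ch. IV §2. [FritzscheGrauert2002]
-/

noncomputable section

open scoped Manifold ContDiff Topology
open CategoryTheory AlgebraicGeometry TopologicalSpace Opposite Set Filter

namespace Literature.AlgebraicGeometry.HodgeTheory

open Literature.AlgebraicGeometry.Motives Literature.AlgebraicGeometry.Motives.RatFn
  Literature.AlgebraicGeometry.Motives.AlgPoints Literature.AlgebraicGeometry.Motives.AnalytificationKaehler
  Literature.NumberTheory.Transcendental Literature.Geometry.Kaehler

/-! ### Metrics on the tensor product and on the inverse of cocycle line bundles -/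

section Metric

variable {ι κ : Type*} {E : Type*} [NormedAddCommGroup E] [NormedSpace ℂ E]
  {M : Type*} [TopologicalSpace M] [ChartedSpace E M]

/-- **The product metric on `L ⊗ L'` and its Chern form** (Voisin I, §3.3.1 with Thm. 4.49 / §7.1.3): for
metrics `h` on `L`, `h'` on `L'` the weights `h_i h'_k` (written `exp (log h_i + log h'_k)`, which agrees with
the product on `U_i ∩ V_k`) form a Hermitian metric on `L ⊗ L'` (`|g_ij g'_kl|² = |g_ij|² |g'_kl|²`), whose
Chern form in the frame `σ_i ⊗ τ_k` is `(1/2iπ) ∂∂̄ log (h_i h'_k) = ω_i + ω'_k` at every point of `U_i ∩ V_k`.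
[cite: VoisinHodgeI2002, §3.3.1 and §7.1.3] -/
theorem _root_.Literature.Geometry.Kaehler.HolomorphicLineBundle.HermitianMetric.exists_tensor_localChernForm_eq_add
    [IsManifold 𝓘(ℝ, E) ∞ M] [IsManifold 𝓘(ℂ, E) ω M]
    {L : HolomorphicLineBundle ι E M} {L' : HolomorphicLineBundle κ E M} (h : L.HermitianMetric)
    (h' : L'.HermitianMetric) :
    ∃ H : (L.tensor L').HermitianMetric, ∀ p, ∀ x ∈ (L.tensor L').baseSet p,
      H.localChernForm p x = h.localChernForm p.1 x + h'.localChernForm p.2 x := by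
  obtain ⟨H, hH⟩ : ∃ H : (L.tensor L').HermitianMetric,
      ∀ p x, H.weight p x = Real.exp (Real.log (h.weight p.1 x) + Real.log (h'.weight p.2 x)) := by
    refine ⟨⟨fun p x ↦ Real.exp (Real.log (h.weight p.1 x) + Real.log (h'.weight p.2 x)), fun p x _ ↦ Real.exp_pos _,
      fun p x hx ↦ ?_, fun p q x hx ↦ ?_⟩, fun _ _ ↦ rfl⟩
    · have h1 : ContMDiffWithinAt 𝓘(ℝ, E) 𝓘(ℝ, ℝ) ∞ (fun y ↦ Real.log (h.weight p.1 y)) ((L.tensor L').baseSet p) x :=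
        (Real.contDiffAt_log.2 (h.weight_pos p.1 x hx.1).ne').comp_contMDiffWithinAt
          (((h.contMDiffOn_weight p.1).mono inter_subset_left) x hx)
      have h2 : ContMDiffWithinAt 𝓘(ℝ, E) 𝓘(ℝ, ℝ) ∞ (fun y ↦ Real.log (h'.weight p.2 y)) ((L.tensor L').baseSet p) x :=
        (Real.contDiffAt_log.2 (h'.weight_pos p.2 x hx.2).ne').comp_contMDiffWithinAt
          (((h'.contMDiffOn_weight p.2).mono inter_subset_right) x hx)
      exact Real.contDiff_exp.contDiffAt.comp_contMDiffWithinAt (h1.add h2)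
    · obtain ⟨⟨hp1, hp2⟩, hq1, hq2⟩ := hx
      rw [Real.exp_add, Real.exp_add, Real.exp_log (h.weight_pos _ _ hp1), Real.exp_log (h'.weight_pos _ _ hp2),
        Real.exp_log (h.weight_pos _ _ hq1), Real.exp_log (h'.weight_pos _ _ hq2), h.weight_eq p.1 q.1 x ⟨hp1, hq1⟩,
        h'.weight_eq p.2 q.2 x ⟨hp2, hq2⟩, HolomorphicLineBundle.tensor_coordChange_apply, norm_mul, mul_pow]
      ring
  refine ⟨H, fun p x hx ↦ ?_⟩
  -- `log (h_i h'_k) = log h_i + log h'_k` as functions on `M`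
  have hfg : (MForm.ofFun 𝓘(ℝ, E) fun y ↦ (Real.log (H.weight p y) : ℂ)) =
      MForm.ofFun 𝓘(ℝ, E) (h.logWeight p.1) + MForm.ofFun 𝓘(ℝ, E) (h'.logWeight p.2) := by
    rw [← MForm.ofFun_add]
    congr 1
    funext y
    rw [hH, Real.log_exp, Pi.add_apply]
    push_cast
    rfl
  have hf := h.eventually_smoothAt_ofFun_logWeight hx.1
  have hg := h'.eventually_smoothAt_ofFun_logWeight hx.2
  -- `d` and `∘ J` split near `x`, where both potentials are smooth
  have h1 : ∀ᶠ z in 𝓝 x, (mextDeriv (MForm.ofFun 𝓘(ℝ, E) (h.logWeight p.1) + MForm.ofFun 𝓘(ℝ, E) (h'.logWeight p.2))).compJ z =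
      ((mextDeriv (MForm.ofFun 𝓘(ℝ, E) (h.logWeight p.1))).compJ +
        (mextDeriv (MForm.ofFun 𝓘(ℝ, E) (h'.logWeight p.2))).compJ) z := by
    filter_upwards [hf, hg] with z hfz hgz
    ext v
    rw [MForm.compJ_apply, mextDeriv_add_apply hfz hgz]
    rfl
  have hsf := (MForm.SmoothAt.mextDeriv hf).compJ
  have hsg := (MForm.SmoothAt.mextDeriv hg).compJ
  simp only [HolomorphicLineBundle.HermitianMetric.localChernForm, Pi.smul_apply]
  rw [hfg, mextDeriv_congr_of_eventuallyEq h1, mextDeriv_add_apply hsf hsg, smul_add]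
  rfl

/-- **The inverse metric on the inverse cocycle and its Chern form**: if `L'` has the trivialising cover of `L`
and the inverse transition functions `g'_ij = g_ji`, then the weights `h_i⁻¹` form a Hermitian metric on `L'`
(`h_i⁻¹ = |g_ji|² h_j⁻¹`) whose Chern forms are `(1/2iπ) ∂∂̄ log h_i⁻¹ = -ω_i` (Voisin I, §3.3.1; the dual line
bundle has the inverse cocycle, Thm. 4.49). [cite: VoisinHodgeI2002, §3.3.1 and Thm. 4.49] -/
theorem _root_.Literature.Geometry.Kaehler.HolomorphicLineBundle.HermitianMetric.exists_localChernForm_eq_neg_of_inv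
    {L L' : HolomorphicLineBundle ι E M} (h : L.HermitianMetric) (hU : ∀ i, L'.baseSet i = L.baseSet i)
    (hg : ∀ i j, ∀ x ∈ L.baseSet i ∩ L.baseSet j, L'.coordChange i j x = L.coordChange j i x) :
    ∃ h' : L'.HermitianMetric, ∀ i, h'.localChernForm i = -h.localChernForm i := by
  obtain ⟨h', hh'⟩ : ∃ h' : L'.HermitianMetric, ∀ i x, h'.weight i x = (h.weight i x)⁻¹ := by
    refine ⟨⟨fun i x ↦ (h.weight i x)⁻¹, fun i x hx ↦ inv_pos.2 (h.weight_pos i x (by rwa [hU] at hx)), fun i ↦ ?_,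
      fun i j x hx ↦ ?_⟩, fun _ _ ↦ rfl⟩
    · rw [hU]
      exact fun x hx ↦ (contDiffAt_inv ℝ (h.weight_pos i x hx).ne').comp_contMDiffWithinAt (h.contMDiffOn_weight i x hx)
    · rw [hU, hU] at hx
      have hj := h.weight_pos j x hx.2
      change (h.weight i x)⁻¹ = _ * (h.weight j x)⁻¹
      rw [hg i j x hx, h.weight_eq j i x ⟨hx.2, hx.1⟩, mul_inv, ← mul_assoc,
        mul_inv_cancel₀ (pow_ne_zero 2 (norm_ne_zero_iff.2 (L.coordChange_ne_zero j i x ⟨hx.2, hx.1⟩))), one_mul]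
  refine ⟨h', fun i ↦ ?_⟩
  have hfun : (MForm.ofFun 𝓘(ℝ, E) fun x ↦ (Real.log (h'.weight i x) : ℂ)) =
      (-1 : ℝ) • MForm.ofFun 𝓘(ℝ, E) fun x ↦ (Real.log (h.weight i x) : ℂ) := by
    funext x
    ext v
    change (Real.log (h'.weight i x) : ℂ) = (-1 : ℝ) • (Real.log (h.weight i x) : ℂ)
    rw [hh', Real.log_inv, ← Complex.coe_smul, smul_eq_mul]
    push_cast
    ring
  have hJ : ∀ (c : ℝ) (α : MForm 𝓘(ℝ, E) M ℂ 1), (c • α).compJ = c • α.compJ := fun c α ↦ by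
    funext x
    ext v
    rfl
  rw [HolomorphicLineBundle.HermitianMetric.localChernForm, HolomorphicLineBundle.HermitianMetric.localChernForm, hfun,
    mextDeriv_smul, hJ, mextDeriv_smul, smul_comm, neg_one_smul]

end Metric

/-! ### `ch₁` of tensor products, inverses and isomorphic cocycles on a Hodge model -/

namespace HodgeModel

variable {n : ℕ} {X : SchemeOver ℂ}

/-- **Holomorphically isomorphic cocycles have the same Chern character classes** on a Hodge model
(`CocycleIso.chernCharacterDeRham_eq`: Kobayashi II §1 Axiom 2, with Chern–Weil II discharged; `A.pullback` is
injective). [cite: Kobayashi1987, Ch. II §1 Axiom 2 and §2 Thm. 2.16] -/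
theorem chernCharacter_eq_of_analyticallyEquivalent (A : HodgeModel n X) {ι ι' : Type} {r : ℕ}
    {V₁ : SmoothComplexVectorBundle ι A.model A.carrier r} {V₂ : SmoothComplexVectorBundle ι' A.model A.carrier r}
    (h : V₁.AnalyticallyEquivalent V₂) (p : ℕ) : A.chernCharacter V₁ p = A.chernCharacter V₂ p := by
  obtain ⟨Φ, hΦ⟩ := h
  apply A.pullback_injective (2 * p)
  rw [A.pullback_chernCharacter_eq, A.pullback_chernCharacter_eq,
    Φ.chernCharacterDeRham_eq (SmoothComplexVectorBundle.mk_eq_mk_of_isChernCharacterForm_holds A.model A.carrier)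
      hΦ.isSmooth p]

/-- **`ch₁(L ⊗ L') = ch₁(L) + ch₁(L')` in `H²(X(ℂ); ℂ)`** for cocycle line bundles on a Hodge model: `c₁` is
represented by the Chern form of any Hermitian metric (Voisin I, §3.3.1 with Thm. 7.10; `HodgeModel.pullback_chernCharacter`),
and the Chern form of the product metric is the sum of the Chern forms (`exists_tensor_localChernForm_eq_add`).
[cite: VoisinHodgeI2002, §3.3.1 and Thm. 7.10] [cite: Kobayashi1987, Ch. II §1 (1.10)] -/
theorem chernCharacter_tensor_toSmoothCocycle (A : HodgeModel n X) {ι κ : Type}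
    (L : HolomorphicLineBundle ι A.model A.carrier) (L' : HolomorphicLineBundle κ A.model A.carrier) :
    A.chernCharacter (L.tensor L').toSmoothCocycle 1 =
      A.chernCharacter L.toSmoothCocycle 1 + A.chernCharacter L'.toSmoothCocycle 1 := by
  obtain ⟨h⟩ := L.nonempty_hermitianMetric
  obtain ⟨h'⟩ := L'.nonempty_hermitianMetric
  obtain ⟨θ, hs, hc, hθ⟩ := h.exists_isChernForm
  obtain ⟨θ', hs', hc', hθ'⟩ := h'.exists_isChernForm
  obtain ⟨H, hH⟩ := h.exists_tensor_localChernForm_eq_add h'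
  have hsum : H.IsChernForm (θ + θ') := fun p x hx ↦ by
    rw [Pi.add_apply, hθ p.1 x hx.1, hθ' p.2 x hx.2, hH p x hx]
  have hs2 : IsSmoothForm (θ + θ') := hs.add hs'
  have hc2 : IsClosedForm (θ + θ') := by
    rw [IsClosedForm, mextDeriv_add hs hs', hc, hc', add_zero]
  apply A.pullback_injective (2 * 1)
  rw [map_add, A.pullback_chernCharacter _ 1 H.chernConnection hs2 hc2 (H.isChernCharacterForm_of_isChernForm hsum),
    A.pullback_chernCharacter _ 1 h.chernConnection hs hc (h.isChernCharacterForm_of_isChernForm hθ),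
    A.pullback_chernCharacter _ 1 h'.chernConnection hs' hc' (h'.isChernCharacterForm_of_isChernForm hθ'),
    ← map_add, ← map_add]
  rfl

/-- **`ch₁(L⁻¹) = -ch₁(L)` in `H²(X(ℂ); ℂ)`**: a cocycle line bundle `L'` on the cover of `L` with the inverse
transition functions `g_ji` (the dual bundle, Voisin I Thm. 4.49) has the opposite first Chern character class
(the metric `h⁻¹` has Chern form `-ω`, `exists_localChernForm_eq_neg_of_inv`).
[cite: VoisinHodgeI2002, §3.3.1 and Thm. 7.10] [cite: Kobayashi1987, Ch. II §1 (1.10)] -/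
theorem chernCharacter_toSmoothCocycle_eq_neg_of_inv (A : HodgeModel n X) {ι : Type}
    (L L' : HolomorphicLineBundle ι A.model A.carrier) (hU : ∀ i, L'.baseSet i = L.baseSet i)
    (hg : ∀ i j, ∀ x ∈ L.baseSet i ∩ L.baseSet j, L'.coordChange i j x = L.coordChange j i x) :
    A.chernCharacter L'.toSmoothCocycle 1 = -A.chernCharacter L.toSmoothCocycle 1 := by
  obtain ⟨h⟩ := L.nonempty_hermitianMetric
  obtain ⟨θ, hs, hc, hθ⟩ := h.exists_isChernForm
  obtain ⟨h', hh'⟩ := h.exists_localChernForm_eq_neg_of_inv hU hg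
  have hθ' : h'.IsChernForm ((-1 : ℂ) • θ) := fun i x hx ↦ by
    rw [Pi.smul_apply, hθ i x (by rwa [hU] at hx), hh', Pi.neg_apply, neg_one_smul]
  have hs' : IsSmoothForm ((-1 : ℂ) • θ) := hs.smul_complex _
  have hc' : IsClosedForm ((-1 : ℂ) • θ) := by
    rw [IsClosedForm, Literature.NumberTheory.Transcendental.mextDeriv_smul_complex_holds, hc, smul_zero]
  apply A.pullback_injective (2 * 1)
  rw [A.pullback_chernCharacter L'.toSmoothCocycle 1 h'.chernConnection hs' hc' (h'.isChernCharacterForm_of_isChernForm hθ'),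
    map_neg, A.pullback_chernCharacter L.toSmoothCocycle 1 h.chernConnection hs hc (h.isChernCharacterForm_of_isChernForm hθ),
    ← neg_one_smul ℂ (A.deRham A.carrier (2 * 1) _), ← _root_.map_smul, ← _root_.map_smul]
  rfl

end HodgeModel

/-! ### Values of rational functions at complex points -/

section Values

variable {X : SchemeOver ℂ} [IsIntegral X.left]

/-- **Identities in `K(X)` hold for the values at complex points**: sections `s₁, …, s₄` over opens containing
`P` with `s₁ s₂ = s₃ s₄` as rational functions take values with `s₁(P) s₂(P) = s₃(P) s₄(P)` (restrict to the
intersection, where `Γ → K(X)` is injective and evaluation is a ring homomorphism; Görtz–Wedhorn I Prop. 3.29).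
[cite: GortzWedhorn2020, Prop. 3.29 (p. 102)] -/
theorem evalOrZero_mul_eq_mul_of_ofSection {O₁ O₂ O₃ O₄ : X.left.Opens} (s₁ : Γ(X.left, O₁)) (s₂ : Γ(X.left, O₂))
    (s₃ : Γ(X.left, O₃)) (s₄ : Γ(X.left, O₄)) {P : ComplexPoints X} (h₁ : P.pt ∈ O₁) (h₂ : P.pt ∈ O₂)
    (h₃ : P.pt ∈ O₃) (h₄ : P.pt ∈ O₄)
    (H : ofSection (genericPoint_mem_of_mem h₁) s₁ * ofSection (genericPoint_mem_of_mem h₂) s₂ =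
      ofSection (genericPoint_mem_of_mem h₃) s₃ * ofSection (genericPoint_mem_of_mem h₄) s₄) :
    evalOrZero O₁ s₁ P * evalOrZero O₂ s₂ P = evalOrZero O₃ s₃ P * evalOrZero O₄ s₄ P := by
  -- adapted from `evalOrZero_mul_eq_pow_mul_of_ofSection` (TautologicalCocycleLinEquivUnits)
  have hO : P.pt ∈ (O₁ ⊓ O₂) ⊓ (O₃ ⊓ O₄) := ⟨⟨h₁, h₂⟩, h₃, h₄⟩
  have e₁ : (O₁ ⊓ O₂) ⊓ (O₃ ⊓ O₄) ≤ O₁ := inf_le_left.trans inf_le_left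
  have e₂ : (O₁ ⊓ O₂) ⊓ (O₃ ⊓ O₄) ≤ O₂ := inf_le_left.trans inf_le_right
  have e₃ : (O₁ ⊓ O₂) ⊓ (O₃ ⊓ O₄) ≤ O₃ := inf_le_right.trans inf_le_left
  have e₄ : (O₁ ⊓ O₂) ⊓ (O₃ ⊓ O₄) ≤ O₄ := inf_le_right.trans inf_le_right
  rw [← evalOrZero_map_homOfLE e₁ s₁ hO, ← evalOrZero_map_homOfLE e₂ s₂ hO, ← evalOrZero_map_homOfLE e₃ s₃ hO,
    ← evalOrZero_map_homOfLE e₄ s₄ hO, evalOrZero_of_mem _ hO, evalOrZero_of_mem _ hO, evalOrZero_of_mem _ hO,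
    evalOrZero_of_mem _ hO, ← evalRingHom_apply, ← evalRingHom_apply, ← evalRingHom_apply, ← evalRingHom_apply,
    ← map_mul, ← map_mul]
  congr 1
  refine section_ext fun hg ↦ ?_
  simp only [map_mul, ofSection_map]
  exact H

/-- Values version of an identity `s₁ = s₃ s₄` in `K(X)` (three sections over opens containing `P`).
[cite: GortzWedhorn2020, Prop. 3.29 (p. 102)] -/
theorem evalOrZero_eq_mul_of_ofSection {O₁ O₃ O₄ : X.left.Opens} (s₁ : Γ(X.left, O₁)) (s₃ : Γ(X.left, O₃))
    (s₄ : Γ(X.left, O₄)) {P : ComplexPoints X} (h₁ : P.pt ∈ O₁) (h₃ : P.pt ∈ O₃) (h₄ : P.pt ∈ O₄)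
    (H : ofSection (genericPoint_mem_of_mem h₁) s₁ =
      ofSection (genericPoint_mem_of_mem h₃) s₃ * ofSection (genericPoint_mem_of_mem h₄) s₄) :
    evalOrZero O₁ s₁ P = evalOrZero O₃ s₃ P * evalOrZero O₄ s₄ P := by
  have hO : P.pt ∈ O₁ ⊓ (O₃ ⊓ O₄) := ⟨h₁, h₃, h₄⟩
  have e₁ : O₁ ⊓ (O₃ ⊓ O₄) ≤ O₁ := inf_le_left
  have e₃ : O₁ ⊓ (O₃ ⊓ O₄) ≤ O₃ := inf_le_right.trans inf_le_left
  have e₄ : O₁ ⊓ (O₃ ⊓ O₄) ≤ O₄ := inf_le_right.trans inf_le_right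
  rw [← evalOrZero_map_homOfLE e₁ s₁ hO, ← evalOrZero_map_homOfLE e₃ s₃ hO, ← evalOrZero_map_homOfLE e₄ s₄ hO,
    evalOrZero_of_mem _ hO, evalOrZero_of_mem _ hO, evalOrZero_of_mem _ hO, ← evalRingHom_apply, ← evalRingHom_apply,
    ← evalRingHom_apply, ← map_mul]
  congr 1
  refine section_ext fun hg ↦ ?_
  simp only [map_mul, ofSection_map]
  exact H

/-- Values version of an identity `s₁ = s₂` in `K(X)` (two sections over opens containing `P`).
[cite: GortzWedhorn2020, Prop. 3.29 (p. 102)] -/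
private theorem evalOrZero_congr_of_ofSection_eq {O₁ O₂ : X.left.Opens} (s₁ : Γ(X.left, O₁)) (s₂ : Γ(X.left, O₂))
    {P : ComplexPoints X} (h₁ : P.pt ∈ O₁) (h₂ : P.pt ∈ O₂)
    (H : ofSection (genericPoint_mem_of_mem h₁) s₁ = ofSection (genericPoint_mem_of_mem h₂) s₂) :
    evalOrZero O₁ s₁ P = evalOrZero O₂ s₂ P := by
  have hO : P.pt ∈ O₁ ⊓ O₂ := ⟨h₁, h₂⟩
  rw [← evalOrZero_map_homOfLE (inf_le_left : O₁ ⊓ O₂ ≤ O₁) s₁ hO,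
    ← evalOrZero_map_homOfLE (inf_le_right : O₁ ⊓ O₂ ≤ O₂) s₂ hO]
  congr 1
  refine section_ext fun hg ↦ ?_
  simp only [ofSection_map]
  exact H

/-- **The transition functions of `𝒪_X(D + D')` at complex points are products**: on
`U_i ∩ V_k ∩ U_j ∩ V_l`, `(f_i f'_k)/(f_j f'_l) = (f_i/f_j) (f'_k/f'_l)` evaluated at a complex point
(Görtz–Wedhorn I (11.9): `(U_i, f_i) + (V_k, f'_k) = (U_i ∩ V_k, f_i f'_k)`). [cite: GortzWedhorn2020, Section (11.9) (p. 374)] -/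
theorem evalOrZero_transFun_add (D D' : CartierDivisor X.left) (P : ComplexPoints X) {i j : D.ι} {k l : D'.ι}
    (hi : P.pt ∈ D.U i) (hj : P.pt ∈ D.U j) (hk : P.pt ∈ D'.U k) (hl : P.pt ∈ D'.U l) :
    evalOrZero ((D + D').U (i, k) ⊓ (D + D').U (j, l)) ((D + D').transFun (i, k) (j, l)) P =
      evalOrZero (D.U i ⊓ D.U j) (D.transFun i j) P * evalOrZero (D'.U k ⊓ D'.U l) (D'.transFun k l) P := by
  refine evalOrZero_eq_mul_of_ofSection ((D + D').transFun (i, k) (j, l)) (D.transFun i j) (D'.transFun k l)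
    (P := P) (show P.pt ∈ (D + D').U (i, k) ⊓ (D + D').U (j, l) from ⟨⟨hi, hk⟩, hj, hl⟩) ⟨hi, hj⟩ ⟨hk, hl⟩ ?_
  rw [CartierDivisor.ofSection_transFun, CartierDivisor.ofSection_transFun, CartierDivisor.ofSection_transFun]
  change D.f i * D'.f k / (D.f j * D'.f l) = D.f i / D.f j * (D'.f k / D'.f l)
  rw [mul_div_mul_comm]

end Values

/-! ### `ch(D + D') = ch(D) + ch(D')` -/

section Cartier

variable {n : ℕ} {X : SchemeOver ℂ} [IsIntegral X.left]
  {E : Type*} [NormedAddCommGroup E] [NormedSpace ℂ E] [FiniteDimensional ℂ E]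
  {M : Type*} [TopologicalSpace M] [ChartedSpace E M] [IsManifold 𝓘(ℂ, E) ω M] [IsManifold 𝓘(ℝ, E) ∞ M]
  {φ : M → ComplexPoints X} (hφ : IsAnalytification E X n φ)

/-- **`𝒪_X(D + D')^an` is the tensor product cocycle `𝒪_X(D)^an ⊗ 𝒪_X(D')^an`** — same cover `U_i ∩ V_k`, same
transition functions `(f_i/f_j)(f'_k/f'_l)` — hence holomorphically isomorphic to it (Görtz–Wedhorn I, Prop. 11.21:
`D ↦ 𝒪_X(D)` is a homomorphism). [cite: GortzWedhorn2020, Prop. 11.21 and Section (11.9)] -/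
theorem analyticallyEquivalent_cartierDivisorCocycle_add (D D' : CartierDivisor X.left) :
    SmoothComplexVectorBundle.AnalyticallyEquivalent (cartierDivisorCocycle hφ (D + D'))
      ((cartierDivisorLineBundle hφ D).tensor (cartierDivisorLineBundle hφ D')).toSmoothCocycle :=
  SmoothComplexVectorBundle.analyticallyEquivalent_of_coordChange_eq (fun _ ↦ rfl) (fun p q x hx ↦ by
    ext a b
    rw [cartierDivisorCocycle_coordChange_apply, HolomorphicLineBundle.toSmoothCocycle_coordChange_apply,
      HolomorphicLineBundle.tensor_coordChange_apply]
    exact evalOrZero_transFun_add D D' (φ x) hx.1.1 hx.2.1 hx.1.2 hx.2.2)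
    (HolomorphicLineBundle.toSmoothCocycle_isHolomorphic _)

/-- **`ch(D + D') = ch(D) + ch(D')`** for the first Chern character classes of the cocycles `𝒪_X(·)^an` of
Cartier divisors on a Hodge model (`𝒪(D + D')^an ≅ 𝒪(D)^an ⊗ 𝒪(D')^an` and `ch₁` of a tensor product of line
cocycles is the sum). [cite: GortzWedhorn2020, Prop. 11.21] [cite: Kobayashi1987, Ch. II §1 (1.10)] -/
theorem HodgeModel.chernCharacter_cartierDivisorCocycle_add (A : HodgeModel n X) (D D' : CartierDivisor X.left) :
    A.chernCharacter (cartierDivisorCocycle A.isAnalytification (D + D')) 1 =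
      A.chernCharacter (cartierDivisorCocycle A.isAnalytification D) 1 +
        A.chernCharacter (cartierDivisorCocycle A.isAnalytification D') 1 := by
  rw [A.chernCharacter_eq_of_analyticallyEquivalent (analyticallyEquivalent_cartierDivisorCocycle_add A.isAnalytification D D') 1]
  exact A.chernCharacter_tensor_toSmoothCocycle (cartierDivisorLineBundle _ D) (cartierDivisorLineBundle _ D')

/-! ### Linear equivalence: `D ∼ D' ⟹ 𝒪(D)^an ≅ 𝒪(D')^an ⟹ ch(D) = ch(D')` -/

/-- **The units of a linear equivalence are a holomorphic isomorphism of the cocycles.** If `h ∈ K(X)` satisfies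
`f_i h / f'_a ∈ 𝒪_{X,x}^×` for all `x ∈ U_i ∩ U'_a` (`CartierDivisor.linEquiv_iff`; Görtz–Wedhorn I (11.9) and
Prop. 11.21: `CaCl(X) ≅ Pic(X)` on representatives), then the matrices `λ_{a i} = f'_a/(f_i h)` — regular on
`U_i ∩ U'_a`, hence holomorphic on `φ⁻¹((U_i ∩ U'_a)(ℂ))` (Serre, GAGA §2 n°6), with non-zero values — satisfy
condition (C) of Fritzsche–Grauert IV §2, `λ_{a i} (f_i/f_j) = (f'_a/f'_b) λ_{b j}`, an identity in `K(X)`.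
[cite: GortzWedhorn2020, Section (11.9) and Prop. 11.21] [cite: FritzscheGrauert2002, Ch. IV §2 (C)]
[cite: SerreGAGA1956, §2 n°6] -/
theorem analyticallyEquivalent_cartierDivisorCocycle_of_isUnitAt (D D' : CartierDivisor X.left)
    (h : X.left.functionField) (H : ∀ i a (x : X.left), x ∈ D.U i → x ∈ D'.U a → IsUnitAt x (D.f i * h / D'.f a)) :
    SmoothComplexVectorBundle.AnalyticallyEquivalent (cartierDivisorCocycle hφ D) (cartierDivisorCocycle hφ D') := by
  classical
  -- the units `λ_{a i} = f'_a / (f_i h)`, regular on `U_i ∩ U'_a`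
  have hreg : ∀ (i : D.ι) (a : D'.ι), ∀ y ∈ D.U i ⊓ D'.U a, IsRegularAt y (D'.f a / (D.f i * h)) := fun i a y hy ↦ by
    rw [← inv_div]
    exact (H i a y hy.1 hy.2).inv.isRegularAt
  obtain ⟨u, hu⟩ : ∃ u : D.ι → D'.ι → M → ℂ, u = fun i a x ↦
      if hO : genericPoint X.left ∈ D.U i ⊓ D'.U a then
        evalOrZero (D.U i ⊓ D'.U a) (sectionOf hO _ (hreg i a)) (φ x) else 0 := ⟨_, rfl⟩
  have hu_of_mem : ∀ {i : D.ι} {a : D'.ι} {x : M} (hx : (φ x).pt ∈ D.U i ⊓ D'.U a),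
      u i a x = evalOrZero (D.U i ⊓ D'.U a) (sectionOf (genericPoint_mem_of_mem hx) _ (hreg i a)) (φ x) := fun hx ↦ by
    rw [hu]
    exact dif_pos (genericPoint_mem_of_mem hx)
  refine ⟨⟨fun a i x ↦ Matrix.of fun _ _ ↦ u i a x, fun a i x hx ↦ ?_, fun a b i j x hx ↦ ?_⟩, fun a i p q ↦ ?_⟩
  · -- `λ_{a i}(x) ≠ 0`: a unit of `𝒪_{X, φ x}` does not vanish at `φ x`
    rw [Matrix.isUnit_iff_isUnit_det, Matrix.det_unique, Matrix.of_apply, hu_of_mem ⟨hx.1, hx.2⟩]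
    refine isUnit_iff_ne_zero.2 (evalOrZero_sectionOf_ne_zero _ _ ⟨hx.1, hx.2⟩ ?_)
    rw [← inv_div]
    exact (H i a _ hx.1 hx.2).inv
  · -- condition (C): `λ_{a i} · (f_i/f_j) = (f'_a/f'_b) · λ_{b j}` in `K(X)`
    obtain ⟨⟨hi, hj⟩, ha, hb⟩ := hx
    ext p q
    rw [Subsingleton.elim p 0, Subsingleton.elim q 0]
    simp only [Matrix.mul_apply, Fin.sum_univ_one, Matrix.of_apply, cartierDivisorCocycle_coordChange_apply]
    rw [hu_of_mem ⟨hi, ha⟩, hu_of_mem ⟨hj, hb⟩]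
    refine evalOrZero_mul_eq_mul_of_ofSection _ _ _ _ ⟨hi, ha⟩ ⟨hi, hj⟩ ⟨ha, hb⟩ ⟨hj, hb⟩ ?_
    rw [ofSection_sectionOf, ofSection_sectionOf, CartierDivisor.ofSection_transFun, CartierDivisor.ofSection_transFun]
    have h1 := D.f_ne_zero i
    have h2 := D.f_ne_zero j
    have h3 := D'.f_ne_zero b
    by_cases hh : h = 0
    · simp [hh]
    field_simp
  · -- holomorphy of `λ_{a i}` (regular functions are holomorphic on an analytification)
    simp only [Matrix.of_apply]
    by_cases hO : genericPoint X.left ∈ D.U i ⊓ D'.U a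
    · have heq : (fun x ↦ u i a x) = fun x ↦ evalOrZero (D.U i ⊓ D'.U a) (sectionOf hO _ (hreg i a)) (φ x) := by
        funext x
        rw [hu]
        exact dif_pos hO
      rw [heq]
      exact (IsAnalytification.mdifferentiableOn_evalOrZero_opens_holds hφ (D.U i ⊓ D'.U a) _).mono
        fun x hx ↦ ⟨hx.1, hx.2⟩
    · exact fun x hx ↦ absurd (genericPoint_mem_of_mem (⟨hx.1, hx.2⟩ : (φ x).pt ∈ D.U i ⊓ D'.U a)) hO

/-- **Linearly equivalent Cartier divisors have the same `ch₁(𝒪_X(·)^an)`** on a Hodge model: `D ∼ D'` makes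
`𝒪(D)^an ≅ 𝒪(D')^an` holomorphically (`analyticallyEquivalent_cartierDivisorCocycle_of_isUnitAt`), and isomorphic
cocycles have the same Chern character (Kobayashi II §1 Axiom 2). [cite: GortzWedhorn2020, Prop. 11.21]
[cite: Kobayashi1987, Ch. II §1 Axiom 2] -/
theorem HodgeModel.chernCharacter_cartierDivisorCocycle_eq_of_linEquiv (A : HodgeModel n X) {D D' : CartierDivisor X.left}
    (hDD' : D.LinEquiv D') :
    A.chernCharacter (cartierDivisorCocycle A.isAnalytification D) 1 =
      A.chernCharacter (cartierDivisorCocycle A.isAnalytification D') 1 := by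
  obtain ⟨h, -, H⟩ := (CartierDivisor.linEquiv_iff D D').1 hDD'
  exact A.chernCharacter_eq_of_analyticallyEquivalent
    (analyticallyEquivalent_cartierDivisorCocycle_of_isUnitAt A.isAnalytification D D' h H) 1

/-- **`ch(m • D) = m • ch(D)`** (`(m + 1) • D` and `m • D + D` present the same divisor, `f_i^{m+1}/(f_a^m f_b)`
being units; `0 • D = (U_i, 1)` presents the same divisor as `0 • D + 0 • D`, so `ch(0 • D) = 2 ch(0 • D) = 0`).
[cite: GortzWedhorn2020, Section (11.9) and Prop. 11.21] -/
theorem HodgeModel.chernCharacter_cartierDivisorCocycle_smul (A : HodgeModel n X) (m : ℕ) (D : CartierDivisor X.left) :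
    A.chernCharacter (cartierDivisorCocycle A.isAnalytification (m • D)) 1 =
      (m : ℂ) • A.chernCharacter (cartierDivisorCocycle A.isAnalytification D) 1 := by
  induction m with
  | zero =>
    have h0 : (0 • D).LinEquiv (0 • D + 0 • D) :=
      CartierDivisor.SameDivisor.linEquiv fun i p x _ _ ↦ by
        change IsUnitAt x (D.f i ^ 0 / (D.f p.1 ^ 0 * D.f p.2 ^ 0))
        rw [pow_zero, pow_zero, pow_zero, mul_one, div_one]
        exact isUnitAt_one
    have h := A.chernCharacter_cartierDivisorCocycle_eq_of_linEquiv h0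
    rw [A.chernCharacter_cartierDivisorCocycle_add] at h
    rw [Nat.cast_zero, zero_smul]
    exact left_eq_add.1 h
  | succ m ih =>
    have h1 : ((m + 1) • D).LinEquiv (m • D + D) :=
      CartierDivisor.SameDivisor.linEquiv fun i p x hi hp ↦ by
        change IsUnitAt x (D.f i ^ (m + 1) / (D.f p.1 ^ m * D.f p.2))
        rw [pow_succ, mul_div_mul_comm, ← div_pow]
        exact ((D.isUnitAt_div i p.1 x hi hp.1).pow m).mul (D.isUnitAt_div i p.2 x hi hp.2)
    rw [A.chernCharacter_cartierDivisorCocycle_eq_of_linEquiv h1, A.chernCharacter_cartierDivisorCocycle_add, ih,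
      Nat.cast_succ, add_smul, one_smul]

/-! ### Hyperplane divisors: `𝒪_X(D_Ψ)^an` is the inverse of the tautological cocycle -/

/-- **The cocycle of a hyperplane divisor.** For a morphism `Ψ : X ⟶ ℙᴷ` with generating sections `Ψ^*x_a` in
chart form (`GeneratingSections.affineChartData`, Hartshorne II Thm. 7.1) and the divisor `D_Ψ = (Ψ^*x_j)` of a
generating section (`GeneratingSections.divisor`, local equations `x_j/x_a`), the cocycle `𝒪_X(D_Ψ)^an`
(transition functions `(x_j/x_a)/(x_j/x_b) = Ψ^*(x_b/x_a)`) is holomorphically isomorphic to EVERY rank-one cocycle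
`W` whose trivialising sets are chart domains `φ⁻¹(Ψ⁻¹D₊(x_{g c})(ℂ))` and whose transition functions are the
affine coordinates `Ψ^*(x_{g d}/x_{g c}) ∘ φ` (`coordFun`), for any reindexing `g` — e.g. the inverse of the
tautological cocycle `𝒪(-1)|_X`, or a tensor product of such along a Segre embedding: the matrices are
`λ_{c a} = Ψ^*(x_a/x_{g c}) ∘ φ` (condition (C) is the cocycle rule of the ratios). [cite: Hartshorne1977, II Thm. 7.1]
[cite: GriffithsHarris1978, Ch. 1 §1 pp. 144–145] [cite: FritzscheGrauert2002, Ch. IV §2 (C)] -/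
theorem analyticallyEquivalent_cartierDivisorCocycle_divisor {K : ℕ} {κ : Type*} (Ψ : X ⟶ projectiveSpace K ℂ)
    (j : Fin (K + 1)) (hj : genericPoint X.left ∈ (GeneratingSections.affineChartData Ψ).U j)
    (W : SmoothComplexVectorBundle κ E M 1) (g : κ → Fin (K + 1)) (hWU : ∀ c, W.baseSet c = chartDom Ψ φ (g c))
    (hWg : ∀ c d, ∀ x ∈ W.baseSet c ∩ W.baseSet d, W.coordChange c d x 0 0 = coordFun Ψ φ (g c) x (g d)) :
    SmoothComplexVectorBundle.AnalyticallyEquivalent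
      (cartierDivisorCocycle hφ ((GeneratingSections.affineChartData Ψ).divisor j hj)) W := by
  set G := GeneratingSections.affineChartData Ψ with hG
  -- the transition functions of `𝒪_X(D_Ψ)` are the ratios `Ψ^*(x_b/x_a)`, at complex points
  have htrans : ∀ (a b : (G.divisor j hj).ι) (P : ComplexPoints X) (ha : P.pt ∈ G.U a.down.1) (hb : P.pt ∈ G.U b.down.1),
      evalOrZero ((G.divisor j hj).U a ⊓ (G.divisor j hj).U b) ((G.divisor j hj).transFun a b) P =
        evalOrZero (G.U a.down.1) (G.ratio a.down.1 b.down.1) P := by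
    intro a b P ha hb
    refine evalOrZero_congr_of_ofSection_eq ((G.divisor j hj).transFun a b) (G.ratio a.down.1 b.down.1) (P := P)
      (show P.pt ∈ (G.divisor j hj).U a ⊓ (G.divisor j hj).U b from ⟨ha, hb⟩) ha ?_
    rw [CartierDivisor.ofSection_transFun]
    change G.ratioFn a.down.1 j a.down.2 / G.ratioFn b.down.1 j b.down.2 = G.ratioFn a.down.1 b.down.1 _
    rw [div_eq_iff (G.ratioFn_ne_zero _ j b.down.2 hj), G.ratioFn_mul_ratioFn]
  have hV : ∀ {c : κ} {x : M}, x ∈ W.baseSet c → x ∈ chartDom Ψ φ (g c) := fun {c x} hx ↦ by rwa [hWU] at hx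
  refine ⟨⟨fun c a x ↦ Matrix.of fun _ _ ↦ coordFun Ψ φ (g c) x a.down.1, fun c a x hx ↦ ?_, fun c d a b x hx ↦ ?_⟩,
    fun c a p q ↦ ?_⟩
  · rw [Matrix.isUnit_iff_isUnit_det, Matrix.det_unique, Matrix.of_apply]
    exact isUnit_iff_ne_zero.2 ((coordFun_ne_zero_iff (hV hx.2)).2 hx.1)
  · obtain ⟨⟨ha, hb⟩, hc, hd⟩ := hx
    ext p q
    rw [Subsingleton.elim p 0, Subsingleton.elim q 0]
    simp only [Matrix.mul_apply, Fin.sum_univ_one, Matrix.of_apply, cartierDivisorCocycle_coordChange_apply]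
    rw [htrans a b (φ x) ha hb, hWg c d x ⟨hc, hd⟩]
    change coordFun Ψ φ (g c) x a.down.1 * coordFun Ψ φ a.down.1 x b.down.1 = _
    rw [coordFun_mul_coordFun (hV hc) ha, coordFun_mul_coordFun (hV hc) (hV hd)]
  · simp only [Matrix.of_apply]
    exact (IsAnalytification.mdifferentiableOn_evalOrZero_opens_holds hφ (G.U (g c)) (G.ratio (g c) a.down.1)).mono
      fun x hx ↦ hV hx.2

/-- **`ch(D_Ψ) = -ch₁(𝒪(-1)|_X)` for a closed immersion `Ψ : X ⟶ ℙᴷ`**: the cocycle `𝒪_X(D_Ψ)^an` of the hyperplane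
divisor `D_Ψ = (Ψ^*x_j)` (transition functions `Ψ^*(x_b/x_a)`) is the INVERSE of the tautological cocycle
`𝒪(-1)|_X` (`tautologicalBundle Ψ`, transition functions `Ψ^*(x_a/x_b)`; Griffiths–Harris p. 145: `J = [-H]`), and
`ch₁` of the inverse cocycle is `-ch₁` (`chernCharacter_toSmoothCocycle_eq_neg_of_inv`).
[cite: GriffithsHarris1978, Ch. 1 §1 pp. 144–145] [cite: VoisinHodgeI2002, §3.3.2 and §11.1.2] -/
theorem HodgeModel.chernCharacter_cartierDivisorCocycle_divisor_eq_neg (A : HodgeModel n X) {K : ℕ}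
    (Ψ : X ⟶ projectiveSpace K ℂ) [IsClosedImmersion Ψ.left] (j : Fin (K + 1))
    (hj : genericPoint X.left ∈ (GeneratingSections.affineChartData Ψ).U j) :
    A.chernCharacter (cartierDivisorCocycle A.isAnalytification ((GeneratingSections.affineChartData Ψ).divisor j hj)) 1 =
      -A.chernCharacter (tautologicalBundle Ψ A.isAnalytification) 1 := by
  set L : HolomorphicLineBundle (Fin (K + 1)) A.model A.carrier :=
    (tautologicalBundle Ψ A.isAnalytification).toHolomorphicLineBundle (tautologicalBundle_isHolomorphic Ψ _) with hL
  let L' : HolomorphicLineBundle (Fin (K + 1)) A.model A.carrier :=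
    { baseSet := L.baseSet
      isOpen_baseSet := L.isOpen_baseSet
      exists_mem_baseSet := L.exists_mem_baseSet
      coordChange := fun a b x ↦ L.coordChange b a x
      mdifferentiableOn_coordChange := fun a b ↦ (L.mdifferentiableOn_coordChange b a).mono fun x hx ↦ ⟨hx.2, hx.1⟩
      coordChange_ne_zero := fun a b x hx ↦ L.coordChange_ne_zero b a x ⟨hx.2, hx.1⟩
      coordChange_comp := fun a b c x hx ↦ by
        rw [mul_comm]
        exact L.coordChange_comp c b a x ⟨⟨hx.2, hx.1.2⟩, hx.1.1⟩ }
  have h1 := analyticallyEquivalent_cartierDivisorCocycle_divisor A.isAnalytification Ψ j hj L'.toSmoothCocycle id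
    (fun _ ↦ rfl) (fun _ _ _ _ ↦ rfl)
  rw [A.chernCharacter_eq_of_analyticallyEquivalent h1 1,
    A.chernCharacter_toSmoothCocycle_eq_neg_of_inv L L' (fun _ ↦ rfl) (fun _ _ _ _ ↦ rfl),
    ← A.chernCharacter_eq_of_analyticallyEquivalent
      ((tautologicalBundle Ψ A.isAnalytification).analyticallyEquivalent_toHolomorphicLineBundle
        (tautologicalBundle_isHolomorphic Ψ _)) 1]

end Cartier

end Literature.AlgebraicGeometry.HodgeTheory

end
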